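import Literature.IUT.HodgeTheaters.FrobenioidBridgeEx54ivInfKappaReconData
import HarnessLib

/-!
# [IUTchI] Example 5.4 (iv), p. 149: `φ` AS DATA — non-vacuity, the relation to GB-14's records, GB-14's link as the case
# `phi := φ_A` (GAP B = G-L5t9g8-1, item GB-18; PROOF-ONLY companion of `FrobenioidBridgeEx54ivInfKappaReconData.lean` ★ p676074)

S. Mochizuki, *Inter-universal Teichmüller theory I*, kurims manuscript (May 2020), Example 5.4 (iv) p. 149, Example 5.1
(i)/(v) pp. 123–128, Remark 3.1.7 (ii) p. 67. ([IUTchI] Ex 5.4 (iv) p.149) [claim: Mochizuki2012, status: disputed] (D-0012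
claim key, series DISPUTED — elementary statements about OUR typed objects; no side taken on [IUTchIII] Cor. 3.12, D-0045).

Theorems only (nothing of ★ p676074 restated; the UNCONDITIONAL `act ≠ refl` NVs are GB-07's rider ★ p677855
`…InfKappaReconActNontrivial.lean` — `C2Residuals'.exists_act_ne_refl'`, `C2Residuals.exists_act_ne_refl`,
`not_exists_reconEquivariantFor_of_act_eq_refl'` — cited BY NAME, not restated here): (i) `𝕄_{∞κ}(Λ_A)` on `R.phi` is a
pseudo-monoid (`0 ∉`) carrying a NON-CONSTANT `κ`-coric element; (ii) `c2Residuals'_iff` /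
`C2Residuals.exists_c2Residuals'`: new record = GB-14's record ∧ `hEq` AT `R.phi`; GB-14's record for `R` repackages as the new one
OVER `R` (`phi :=` the witness) — SAME inhabitation problem, the refactor only makes the LINK depend on the named iso; (iii)
`infKappaLinkRecon'_mk_funFieldEquiv`: GB-14's link IS the new link at `⟨R, R.funFieldEquiv⟩` (`rfl`); (iv) non-degeneracy /
non-vacuity of ★ p676074 §2.  HONEST LABELS as ★ p676074: an NV that the residual is CONTENTFUL is not a discharge of it; `hEq`
inhabited by nobody; C2 = transported only; COUNT-NEUTRAL; no `instance`/notation/axiom/`sorry`; no abc claim.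
-/

noncomputable section

namespace Literature.IUT.HodgeTheaters

open Literature.AnabelianGeometry.AbsoluteAnabelian
open Literature.AnabelianGeometry.AbsoluteAnabelian.AbsTopIII
open Literature.FieldTheory.FunctionField

universe u

namespace InitialThetaData

section Objects

variable {F K Fbar : Type u} [Field F] [NumberField F] [Field K] [NumberField K] [Algebra F K]
  [Field Fbar] [Algebra F Fbar] [Algebra K Fbar] {E : WeierstrassCurve F} [E.IsElliptic] {l : ℕ}
  {Pb : BadPlacePredicates K} {D : InitialThetaData F K Fbar E l Pb}

/-- **`𝕄_{∞κ}(Λ_A)` on `R.phi` is not reduced to roots of unity** (the `φ`-preimage of GB-04's NON-CONSTANT `κ`-coric witness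
lies in it). ([IUTchI] Rmk 3.1.7 (ii) p.67) [claim: Mochizuki2012, status: disputed] -/
theorem ReconRatObjects'.exists_mem_infKappaSet'_ne_C [CharZero Fbar] (R : D.ReconRatObjects') :
    ∃ f : RatFunc Fbar, algebraMap R.funField R.ratClosure (R.phi.symm f) ∈ R.infKappaSet' ∧ ∀ c : Fbar, f ≠ RatFunc.C c := by
  letI := R.geomAlgebra'
  exact D.exists_isInftyKappaCoricIn_critLocusGeom R.ratClosure

/-- `0 ∉ 𝕄_{∞κ}(Λ_A)` on `R.phi` (GB-01's `zero_notMem_infKappaCoricSetIn`). ([IUTchI] Rmk 3.1.7 (ii) p.67) [claim: Mochizuki2012, status: disputed] -/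
theorem ReconRatObjects'.zero_notMem_infKappaSet' [CharZero Fbar] (R : D.ReconRatObjects') : (0 : R.ratClosure) ∉ R.infKappaSet' :=
  letI := R.geomAlgebra'
  D.critLocusGeom.zero_notMem_infKappaCoricSetIn

/-- The pair `G_φ^{rat} ↷ 𝕄_{∞κ}(Λ_A)` on `R.phi` IS a pseudo-monoid ([IUTchI] §0 p. 33), realised in `Λ_A^×`.
([IUTchI] Ex 5.1 (v) p.127) [claim: Mochizuki2012, status: disputed] -/
theorem ReconRatObjects'.isPseudoMonoid_reconInfKappaCoricPair' [CharZero Fbar] (R : D.ReconRatObjects') :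
    R.reconInfKappaCoricPair'.pm.IsPseudoMonoid :=
  letI := R.funFieldAlgebra'
  haveI := R.isIntegral_ratClosure'
  CoricPair.isPseudoMonoid_ofStableSet _ R.zero_notMem_infKappaSet'

/-- **The new record = GB-14's record ∧ `hEq` AT `R.phi`.** ([IUTchI] Ex 5.4 (iv) p.149) [claim: Mochizuki2012, status: disputed] -/
theorem c2Residuals'_iff (G : D.LocalThetaGeometry) (R : D.ReconRatObjects') :
    D.C2Residuals' G R ↔ D.C2Residuals G R.toReconRatObjects ∧ D.ReconEquivariantFor R.toReconRatObjects R.phi :=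
  ⟨fun ρ => ⟨ρ.toC2Residuals, ρ.hEq⟩, fun h => ⟨h.1.h₁₉, h.1.h₁₁₀, h.2⟩⟩

/-- **Converse repackaging (nothing lost, nothing gained for free)**: GB-14's record for `R` yields a datum-with-`φ` OVER `R` satisfying
the new record (`phi :=` the witness of `hEq : ∃ φ, …`) — SAME inhabitation problem. ([IUTchI] Ex 5.4 (iv) p.149) [claim: Mochizuki2012, status: disputed] -/
theorem C2Residuals.exists_c2Residuals' {G : D.LocalThetaGeometry} {R : D.ReconRatObjects} (ρ : D.C2Residuals G R) :
    ∃ R' : D.ReconRatObjects', R'.toReconRatObjects = R ∧ D.C2Residuals' G R' := by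
  obtain ⟨φ, hφ⟩ := ρ.hEq
  exact ⟨⟨R, φ⟩, rfl, ⟨ρ.h₁₉, ρ.h₁₁₀, hφ⟩⟩

end Objects

section Datum

variable {F K Fbar : Type u} [Field F] [NumberField F] [Field K] [NumberField K]
  [Algebra F K] [Field Fbar] [Algebra F Fbar] [Algebra K Fbar]
  {E : WeierstrassCurve F} [E.IsElliptic] {l : ℕ} {Pb : BadPlacePredicates K}
  (D : InitialThetaData F K Fbar E l Pb) (CG : D.geom.pe.CuspGalois) (hS : D.CuspClassesNormaliserStable) [Fact l.Prime]
  (M : D.TorsionMonodromy) (hA : D.geom.pe.ArrowCoveringClaims)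
  (hI : ∀ k ∈ D.geom.pe.inertia D.geom.pe.ε1, M.tau (D.geom.embK k) = 0)
  (B : ∀ v, v ∈ D.indexCopyBad → D.BadPairAt v) (ΛBad : ∀ v (h : v ∈ D.indexCopyBad), D.LocalArrowLaw CG hS (B v h).H)
  {Gv : D.IndexCopy → Subgroup (Fbar ≃ₐ[F] Fbar)}
  (ES : ∀ v, v ∈ D.indexCopyBad → EvalSectionBinder (D.localDataOfBadPairs CG hS M hA hI B ΛBad v) (Gv v))

/-- **GB-14's link IS the new link at GB-09's chosen comparison `phi := φ_A`** (`rfl`: every primed object at `φ_A` is GB-09's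
object definitionally) — nothing landed is lost. ([IUTchI] Ex 5.4 (iv) p.149) [claim: Mochizuki2012, status: disputed] -/
theorem infKappaLinkRecon'_mk_funFieldEquiv (R : D.ReconRatObjects) :
    D.infKappaLinkRecon' CG hS M hA hI B ΛBad ES ⟨R, R.funFieldEquiv⟩ = D.infKappaLinkRecon CG hS M hA hI B ΛBad ES R := rfl

/-- **Non-degeneracy of the new link's global pseudo-monoid**: for every `Z`, the carrier of `globInfk Z` contains the image
of the `φ`-preimage of a NON-CONSTANT `κ`-coric function. ([IUTchI] Rmk 3.1.7 (ii) p.67) [claim: Mochizuki2012, status: disputed] -/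
theorem exists_globInfk_infKappaLinkRecon'_ne_C (R : D.ReconRatObjects')
    (Z : (D.s5LocalThetaOfBadPairs CG hS M hA hI B ΛBad ES).FAmbGlob) :
    letI := (D.infKappaLinkRecon' CG hS M hA hI B ΛBad ES R).globRatGroup Z
    letI := (D.infKappaLinkRecon' CG hS M hA hI B ΛBad ES R).globRatTop Z
    ∃ (m : ((D.infKappaLinkRecon' CG hS M hA hI B ΛBad ES R).globInfk Z).carrier) (g : RatFunc Fbar),
      (m.val : R.ratClosure) = algebraMap R.funField R.ratClosure (R.phi.symm g) ∧ ∀ c : Fbar, g ≠ RatFunc.C c := by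
  haveI : CharZero Fbar := charZero_of_injective_algebraMap (algebraMap F Fbar).injective
  obtain ⟨g, hg, hne⟩ := R.exists_mem_infKappaSet'_ne_C
  exact ⟨⟨_, hg⟩, g, rfl, hne⟩

/-- **Under `h₁₉` BY NAME there IS a datum-with-`φ` whose link satisfies the clause** (non-vacuous reading of ★ p676074's `∀ R`;
`phi := φ_A`, clause by transport). ([IUTchI] Ex 5.4 (iv) p.149) [claim: Mochizuki2012, status: disputed] -/
theorem exists_ex54ivInfKappaCompat_recon'_of_thm19 (G : D.LocalThetaGeometry) (h₁₉ : Thm_1_9 (D.nfCurveModelLocal G)) :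
    ∃ R : D.ReconRatObjects', BaseThetaDatum.S5Local.Ex54ivInfKappaCompat (D.infKappaLinkRecon' CG hS M hA hI B ΛBad ES R) :=
  ⟨⟨D.reconRatObjectsOfLocal G h₁₉, (D.reconRatObjectsOfLocal G h₁₉).funFieldEquiv⟩,
    D.ex54ivInfKappaCompat_recon' CG hS M hA hI B ΛBad ES _⟩

end Datum

end InitialThetaData

end Literature.IUT.HodgeTheaters

end
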